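import Literature.NumberTheory.GaloisRepresentations.RamificationFiltrationProofs
import HarnessLib

/-!
# Herbrand's theorem for `K̄/E/K`: `Γ_K^v|_E = Gal(E/K)^v` from the finite layers
(trunk GalRep, item C9, companion to `RamificationFiltration.lean`)

D-0014 keeps `Literature/` sorry-free by stating cited results as named facts `def X : Prop`.
The parent file `Literature.NumberTheory.GaloisRepresentations.RamificationFiltration` defines the
absolute upper-numbering filtration `Γ_K^v = Literature.absUpperRamificationSubgroup R 𝔓 v` of
`Gal(K̄/K)` at an ideal `𝔓` of `\bar ℤ_K` as the intersection, over the finite normal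
subextensions `E/K` of `K̄`, of the preimages of the finite-level groups `Gal(E/K)^v` (at `𝔓 ∩ E`),
following Serre's definition `G^v = lim← G(L'/K)^v` for infinite Galois extensions (*Local Fields*,
Ch. IV §3, Remark 1), and states **Herbrand's theorem** `(G/H)^v = G^v H/H` (Prop. 14) for a
finite Galois `L/K` and a normal subextension as the named fact `Literature.herbrand_quotient R E`.
This file proves, from that fact alone (threaded as the hypothesis `hq`, D-0014), the statement
which makes the absolute filtration usable:

* `Literature.NumberTheory.GaloisRepresentations.absUpperRamificationSubgroup_map_eq_of_herbrand_quotient` — **`Γ_K^v|_E = Gal(E/K)^v`**: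
  for `K` of characteristic `0` with `K = Frac R`, `R` Dedekind, `𝔓` a maximal ideal of
  `\bar ℤ_K` with finite residue field `R/(𝔓 ∩ R)`, `E/K` finite normal inside `K̄` and `v : ℝ`,
  the image of `Γ_K^v` under `σ ↦ σ|_E` is all of `Gal(E/K)^v`.  (`⊆` is the definition; `⊇` is
  the passage to the limit: for `g ∈ Gal(E/K)^v` the sets
  `S_{E'} = {σ : σ|_{E'} ∈ Gal(E'/K)^v, σ|_E = g}`, `E' ⊇ E` finite normal, are closed, non-empty
  and decreasing in `E'` by Herbrand's theorem for the layers `E'/E/K`, so they have a common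
  point by compactness of `Γ_K`, and such a point lies in `Γ_K^v`, again by Herbrand's theorem
  for `(E ⊔ E₁)/E₁/K`.)  The number-field case feeds the named fact
  `Literature.NumberTheory.GaloisRepresentations.absUpperRamificationSubgroup_map_absRestrictNormalHom` of `ArtinConductorIntegrality.lean`
  (`ArtinConductorIntegralityProofs.lean`).

On the way:

* **transport of structure** for decomposition, inertia, ramification groups, the Herbrand
  functions and the upper numbering along an equivariant ring isomorphism `e : S₁ ≃ S₂`,
  `e (g • x) = f(g) • e(x)` (`Literature.NumberTheory.GaloisRepresentations.ramificationSubgroup_comap_ringEquiv`,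
  `Literature.NumberTheory.GaloisRepresentations.upperRamificationSubgroup_comap_ringEquiv`, …: `G_i(e⁻¹𝔓) = f⁻¹ G_i(𝔓)`), generalising the
  conjugation lemmas `Ideal.ramificationSubgroup_smul` etc. of `RamificationFiltrationProofs.lean`;
* **Herbrand's theorem for layers `E ≤ E'` of `K̄`** (`Literature.NumberTheory.GaloisRepresentations.absRestrictNormalHom_mem_upper_of_le`:
  `σ|_{E'} ∈ Gal(E'/K)^v ⇒ σ|_E ∈ Gal(E/K)^v`; `Literature.NumberTheory.GaloisRepresentations.exists_absRestrictNormalHom_mem_upper_of_le`: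
  every `g ∈ Gal(E/K)^v` is `σ|_E` with `σ|_{E'} ∈ Gal(E'/K)^v`), obtained from `herbrand_quotient`
  for the finite Galois extension `E'/K` and its normal subextension `restrict hle ≅ E` (Mathlib
  `IntermediateField.restrict`, `restrict_algEquiv`) by transport of structure, after checking
  its hypotheses: `𝔓 ∩ E'` is maximal (`\bar ℤ_K` is integral over `integralClosure R E'`) and
  the residue extension of `𝔓 ∩ E'` over `𝔓 ∩ R` is separable (finite, hence perfect, residue
  field).

## References

* J.-P. Serre, *Local Fields*, GTM 67, Springer 1979, Ch. IV §3: Prop. 14 (Herbrand's theorem)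
  and Remark 1 after Prop. 15 (`G^v` for infinite extensions), p. 75; Ch. I §7 Prop. 22.
  [SerreLocalFields1979]
* J. Neukirch, *Algebraic Number Theory* (1999), Ch. II (10.7); Ch. IV §1 (profinite Galois
  groups). [NeukirchANT1999]
-/

noncomputable section

open scoped Pointwise

namespace Literature.NumberTheory.GaloisRepresentations

/-! ### Transport of structure along an equivariant ring isomorphism -/

section Transport

variable {S₁ S₂ : Type*} [CommRing S₁] [CommRing S₂] {G₁ G₂ : Type*} [Group G₁] [Group G₂]
  [MulSemiringAction G₁ S₁] [MulSemiringAction G₂ S₂]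
  (e : S₁ ≃+* S₂) (f : G₁ →* G₂) (hef : ∀ (g : G₁) (x : S₁), e (g • x) = f g • e x)

include hef

/-- **Transport of inertia groups** along a ring isomorphism `e : S₁ ≃ S₂` equivariant for
`f : G₁ → G₂` (`e (g • x) = f g • e x`): `I_{e⁻¹ 𝔓}(G₁) = f⁻¹ I_𝔓(G₂)`.
Ref: Neukirch, *Algebraic Number Theory*, Ch. I §9, after (9.5) (the case of conjugation).
[folklore] -/
theorem inertia_comap_ringEquiv (𝔓 : Ideal S₂) :
    (𝔓.comap e).inertia G₁ = (𝔓.inertia G₂).comap f := by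
  ext σ
  rw [Subgroup.mem_comap, Ideal.inertia, Ideal.inertia, AddSubgroup.mem_inertia,
    AddSubgroup.mem_inertia]
  constructor
  · intro h y
    obtain ⟨x, rfl⟩ := e.surjective y
    have hx := h x
    rw [Submodule.mem_toAddSubgroup, Ideal.mem_comap, map_sub, hef] at hx
    exact hx
  · intro h x
    have hx := h (e x)
    rw [Submodule.mem_toAddSubgroup, ← hef, ← map_sub] at hx
    exact hx

/-- **Transport of decomposition groups** along an equivariant ring isomorphism:
`D_{e⁻¹ 𝔓}(G₁) = f⁻¹ D_𝔓(G₂)`.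
Ref: Neukirch, *Algebraic Number Theory*, Ch. I §9, after (9.5). [folklore] -/
theorem decompositionSubgroup_comap_ringEquiv (𝔓 : Ideal S₂) :
    (𝔓.comap e).decompositionSubgroup G₁ = (𝔓.decompositionSubgroup G₂).comap f := by
  ext σ
  rw [Subgroup.mem_comap, Ideal.mem_decompositionSubgroup_iff, Ideal.mem_decompositionSubgroup_iff]
  constructor
  · intro h
    ext y
    obtain ⟨x, rfl⟩ := e.surjective y
    rw [Ideal.mem_pointwise_smul_iff_inv_smul_mem, ← map_inv, ← hef]
    have := SetLike.ext_iff.mp h x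
    rw [Ideal.mem_pointwise_smul_iff_inv_smul_mem, Ideal.mem_comap, Ideal.mem_comap] at this
    exact this
  · intro h
    ext x
    rw [Ideal.mem_pointwise_smul_iff_inv_smul_mem, Ideal.mem_comap, Ideal.mem_comap,
      hef, map_inv, ← Ideal.mem_pointwise_smul_iff_inv_smul_mem, h]

/-- **Transport of the lower-numbering ramification groups** along an equivariant ring
isomorphism: `G_i(e⁻¹ 𝔓) = f⁻¹ G_i(𝔓)` (`e⁻¹ (𝔓 ^ (i+1)) = (e⁻¹ 𝔓) ^ (i+1)`).
Ref: Serre, *Local Fields*, Ch. IV §1; Neukirch, *Algebraic Number Theory*, Ch. I §9. [folklore] -/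
theorem ramificationSubgroup_comap_ringEquiv (𝔓 : Ideal S₂) (i : ℕ) :
    (𝔓.comap e).ramificationSubgroup G₁ i =
      (𝔓.ramificationSubgroup G₂ i).comap f := by
  have hpow : (𝔓.comap e) ^ (i + 1) = (𝔓 ^ (i + 1)).comap e := by
    rw [← Ideal.map_symm, ← Ideal.map_symm, Ideal.map_pow]
  rw [Ideal.ramificationSubgroup, Ideal.ramificationSubgroup, Subgroup.comap_inf,
    decompositionSubgroup_comap_ringEquiv e f hef, hpow, inertia_comap_ringEquiv e f hef]

omit hef in
/-- `#(f⁻¹ H) = #H` for a bijective group homomorphism `f` (declared in Mathlib's `Subgroup`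
namespace for dot notation; Mathlib has `Subgroup.card_map_of_injective` but no `comap` version
of this name). [folklore] -/
theorem _root_.Subgroup.card_comap_of_bijective {H : Subgroup G₂} (hf : Function.Bijective f) :
    Nat.card (H.comap f) = Nat.card H := by
  let f' : G₁ ≃* G₂ := MulEquiv.ofBijective f hf
  change Nat.card (H.comap f'.toMonoidHom) = Nat.card H
  rw [Subgroup.comap_equiv_eq_map_symm']
  exact Subgroup.card_map_of_injective f'.symm.injective

variable (hf : Function.Bijective f)
include hf

/-- Transport of the orders `#G_i` along an equivariant ring isomorphism with bijective `f`.
Ref: Serre, *Local Fields*, Ch. IV §1. [folklore] -/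
theorem card_ramificationSubgroup_comap_ringEquiv (𝔓 : Ideal S₂) (i : ℕ) :
    Nat.card ((𝔓.comap e).ramificationSubgroup G₁ i) =
      Nat.card (𝔓.ramificationSubgroup G₂ i) := by
  rw [ramificationSubgroup_comap_ringEquiv e f hef, Subgroup.card_comap_of_bijective f hf]

/-- Transport of the Herbrand integrand `#G_{⌈t⌉}/#G_0` (it only depends on the orders `#G_i`).
Ref: Serre, *Local Fields*, Ch. IV §3. [folklore] -/
theorem herbrandIntegrand_comap_ringEquiv (𝔓 : Ideal S₂) :
    herbrandIntegrand (𝔓.comap e) G₁ = herbrandIntegrand 𝔓 G₂ := by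
  funext t
  simp only [herbrandIntegrand, card_ramificationSubgroup_comap_ringEquiv e f hef hf]

/-- Transport of the Herbrand function `φ`.  Ref: Serre, *Local Fields*, Ch. IV §3. [folklore] -/
theorem herbrandPhi_comap_ringEquiv (𝔓 : Ideal S₂) :
    herbrandPhi (𝔓.comap e) G₁ = herbrandPhi 𝔓 G₂ := by
  funext u
  simp only [herbrandPhi, herbrandIntegrand_comap_ringEquiv e f hef hf]

/-- Transport of the inverse Herbrand function `ψ`.  Ref: Serre, *Local Fields*, Ch. IV §3.
[folklore] -/
theorem herbrandPsi_comap_ringEquiv (𝔓 : Ideal S₂) :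
    herbrandPsi (𝔓.comap e) G₁ = herbrandPsi 𝔓 G₂ := by
  funext v
  simp only [herbrandPsi, herbrandPhi_comap_ringEquiv e f hef hf]

/-- **Transport of the upper-numbering ramification groups** along an equivariant ring
isomorphism with bijective `f`: `G^v(e⁻¹ 𝔓) = f⁻¹ G^v(𝔓)`.
Ref: Serre, *Local Fields*, Ch. IV §3. [folklore] -/
theorem upperRamificationSubgroup_comap_ringEquiv (𝔓 : Ideal S₂) (v : ℝ) :
    upperRamificationSubgroup (𝔓.comap e) G₁ v =
      (upperRamificationSubgroup 𝔓 G₂ v).comap f := by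
  rw [upperRamificationSubgroup, upperRamificationSubgroup, herbrandPsi_comap_ringEquiv e f hef hf,
    ramificationSubgroup_comap_ringEquiv e f hef]

end Transport

/-! ### Layers of `K̄`: Herbrand's theorem transported from `herbrand_quotient` -/

section Layers

open Field

universe u

variable (R : Type*) {K : Type u} [CommRing R] [Field K] [Algebra R K]
  {E E' : IntermediateField K (AlgebraicClosure K)} (hle : E ≤ E')

/-- The `K`-isomorphism `E ≃ restrict hle` (Mathlib `IntermediateField.restrict_algEquiv`) on
underlying elements of `K̄`. [folklore] -/
theorem coe_coe_restrict_algEquiv (x : E) :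
    (((IntermediateField.restrict_algEquiv hle x : IntermediateField.restrict hle) : E') :
      AlgebraicClosure K) = (x : AlgebraicClosure K) := by
  rfl

/-- For a layer `E ≤ E'` of `K̄` the isomorphism of integral closures induced by
`e = restrict_algEquiv hle : E ≃ restrict hle` (Mathlib `AlgEquiv.mapIntegralClosure`) is
equivariant for the conjugation `e.autCongr : Aut(E/K) ≃ Aut(restrict hle/K)`. [folklore] -/
theorem restrict_mapIntegralClosure_smul (g : E ≃ₐ[K] E) (x : integralClosure R E) :
    ((IntermediateField.restrict_algEquiv hle).restrictScalars R).mapIntegralClosure.toRingEquiv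
        (g • x) =
      (IntermediateField.restrict_algEquiv hle).autCongr g •
        ((IntermediateField.restrict_algEquiv hle).restrictScalars R).mapIntegralClosure.toRingEquiv
          x := by
  apply Subtype.ext
  change IntermediateField.restrict_algEquiv hle (g • (x : E)) =
    ((IntermediateField.restrict_algEquiv hle).autCongr g)
      (IntermediateField.restrict_algEquiv hle (x : E))
  rw [AlgEquiv.autCongr_apply, AlgEquiv.trans_apply, AlgEquiv.trans_apply,
    AlgEquiv.symm_apply_apply]
  rfl

/-- The inclusions into `\bar ℤ_K` of `integralClosure R E` and of its copy inside
`integralClosure R E'` agree. [folklore] -/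
theorem integralClosureToAbsIntegers_restrict_mapIntegralClosure (x : integralClosure R E) :
    E'.integralClosureToAbsIntegers R
        ((IntermediateField.restrict hle).integralClosureInclusion R
          (((IntermediateField.restrict_algEquiv hle).restrictScalars R).mapIntegralClosure.toRingEquiv
            x)) =
      E.integralClosureToAbsIntegers R x :=
  Subtype.ext rfl

/-- The prime `𝔓 ∩ E` is the transport of `(𝔓 ∩ E') ∩ restrict hle` along `e`. [folklore] -/
theorem comap_restrict_mapIntegralClosure (𝔓 : Ideal (absIntegers R K)) :
    ((𝔓.comap (E'.integralClosureToAbsIntegers R)).comap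
        ((IntermediateField.restrict hle).integralClosureInclusion R)).comap
        (((IntermediateField.restrict_algEquiv hle).restrictScalars R).mapIntegralClosure.toRingEquiv) =
      𝔓.comap (E.integralClosureToAbsIntegers R) := by
  ext x
  simp only [Ideal.mem_comap]
  rw [← integralClosureToAbsIntegers_restrict_mapIntegralClosure R hle x]

/-- **Transport of the upper filtration of `𝔓 ∩ E` to the copy `restrict hle` of `E` inside
`E'`**: `Gal(E/K)^v = (e.autCongr)⁻¹ Gal(restrict hle/K)^v` (upper filtrations at `𝔓 ∩ E` and at
`(𝔓 ∩ E') ∩ restrict hle`).  Ref: Serre, *Local Fields*, Ch. IV §3. [folklore] -/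
theorem upperRamificationSubgroup_layer (𝔓 : Ideal (absIntegers R K)) (v : ℝ) :
    upperRamificationSubgroup (𝔓.comap (E.integralClosureToAbsIntegers R)) (E ≃ₐ[K] E) v =
      (upperRamificationSubgroup ((𝔓.comap (E'.integralClosureToAbsIntegers R)).comap
          ((IntermediateField.restrict hle).integralClosureInclusion R))
        (IntermediateField.restrict hle ≃ₐ[K] IntermediateField.restrict hle) v).comap
        ((IntermediateField.restrict_algEquiv hle).autCongr).toMonoidHom := by
  rw [← comap_restrict_mapIntegralClosure R hle 𝔓]
  exact upperRamificationSubgroup_comap_ringEquiv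
    (((IntermediateField.restrict_algEquiv hle).restrictScalars R).mapIntegralClosure.toRingEquiv)
    ((IntermediateField.restrict_algEquiv hle).autCongr).toMonoidHom
    (restrict_mapIntegralClosure_smul R hle)
    ((IntermediateField.restrict_algEquiv hle).autCongr).bijective _ v

variable [Normal K E] [Normal K E']

/-- Restricting `σ ∈ Gal(K̄/K)` to `E'` and then to the copy `restrict hle` of `E` inside `E'` is
the conjugate by `e` of `σ|_E` (all three have underlying map `σ` on elements of `E`).
Ref: Serre, *Local Fields*, Ch. I §7 (functoriality of restriction). [folklore] -/
theorem restrictNormalHom_restrict_absRestrictNormalHom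
    [Normal K (IntermediateField.restrict hle)] (σ : absoluteGaloisGroup K) :
    AlgEquiv.restrictNormalHom (IntermediateField.restrict hle) (absRestrictNormalHom E' σ) =
      (IntermediateField.restrict_algEquiv hle).autCongr (absRestrictNormalHom E σ) := by
  apply AlgEquiv.ext
  intro y
  apply Subtype.ext
  apply Subtype.ext
  -- both sides have underlying element `σ (y : K̄)`
  rw [AlgEquiv.restrictNormalHom_apply]
  change ((absRestrictNormalHom E' σ) (y : E') : AlgebraicClosure K) = _
  rw [show ((absRestrictNormalHom E' σ) (y : E') : AlgebraicClosure K) =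
      (absoluteGaloisGroup.toAlgEquiv K σ) ((y : E') : AlgebraicClosure K) from
    AlgEquiv.restrictNormalHom_apply E' _ _]
  rw [AlgEquiv.autCongr_apply, AlgEquiv.trans_apply, AlgEquiv.trans_apply]
  rw [coe_coe_restrict_algEquiv]
  rw [show (((absRestrictNormalHom E σ) ((IntermediateField.restrict_algEquiv hle).symm y) : E) :
      AlgebraicClosure K) = (absoluteGaloisGroup.toAlgEquiv K σ)
        (((IntermediateField.restrict_algEquiv hle).symm y : E) : AlgebraicClosure K) from
    AlgEquiv.restrictNormalHom_apply E _ _]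
  congr 1
  conv_lhs => rw [← (IntermediateField.restrict_algEquiv hle).apply_symm_apply y]
  exact coe_coe_restrict_algEquiv hle _

end Layers

/-! ### Tower Herbrand for layers of `K̄` from `herbrand_quotient` -/

section TowerHerbrand

open Field

universe u

variable (R : Type*) {K : Type u} [CommRing R] [Field K] [Algebra R K]
  {E E' : IntermediateField K (AlgebraicClosure K)} (hle : E ≤ E') (𝔓 : Ideal (absIntegers R K))

/-- `𝔓 ∩ F` is maximal for `𝔓` maximal: `\bar ℤ_K` is integral over `R`, a fortiori over
`integralClosure R F`, and the contraction of a maximal ideal along an integral extension is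
maximal (Mathlib `Ideal.isMaximal_comap_of_isIntegral_of_isMaximal'`).
Ref: Serre, *Local Fields*, Ch. I §6 (going up). [folklore] -/
theorem isMaximal_comap_integralClosureToAbsIntegers [𝔓.IsMaximal]
    (F : IntermediateField K (AlgebraicClosure K)) :
    (𝔓.comap (F.integralClosureToAbsIntegers R)).IsMaximal := by
  refine Ideal.isMaximal_comap_of_isIntegral_of_isMaximal'
    (F.integralClosureToAbsIntegers R).toRingHom ?_ 𝔓
  refine RingHom.IsIntegral.tower_top (algebraMap R (integralClosure R F)) _ ?_
  rw [AlgHom.toRingHom_eq_coe, AlgHom.comp_algebraMap]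
  exact algebraMap_isIntegral_iff.mpr inferInstance

/-- `(𝔓 ∩ F) ∩ R = 𝔓 ∩ R` (the inclusion of `F` commutes with the structure maps). [folklore] -/
theorem under_comap_integralClosureToAbsIntegers (F : IntermediateField K (AlgebraicClosure K)) :
    (𝔓.comap (F.integralClosureToAbsIntegers R)).under R = 𝔓.under R := by
  ext x
  simp only [Ideal.under, Ideal.mem_comap, AlgHom.commutes]

/-- The residue extension of `𝔓 ∩ F` over `𝔓 ∩ R` is separable when the residue field
`R/(𝔓 ∩ R)` is finite: a finite field is perfect and the residue extension is algebraic (it is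
integral).  Ref: Serre, *Local Fields*, Ch. I §4 and Ch. IV (the standing hypothesis "residue
extension separable" is automatic for finite residue fields). [folklore] -/
theorem isSeparable_residue_comap [𝔓.IsMaximal] [Finite (R ⧸ 𝔓.under R)]
    (F : IntermediateField K (AlgebraicClosure K)) :
    Algebra.IsSeparable (R ⧸ (𝔓.comap (F.integralClosureToAbsIntegers R)).under R)
      (integralClosure R F ⧸ 𝔓.comap (F.integralClosureToAbsIntegers R)) := by
  haveI := isMaximal_comap_integralClosureToAbsIntegers R 𝔓 F
  have hunder := under_comap_integralClosureToAbsIntegers R 𝔓 F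
  haveI : ((𝔓.comap (F.integralClosureToAbsIntegers R)).under R).IsMaximal := by
    rw [hunder]
    infer_instance
  letI : Field (R ⧸ (𝔓.comap (F.integralClosureToAbsIntegers R)).under R) := Ideal.Quotient.field _
  letI : Field (integralClosure R F ⧸ 𝔓.comap (F.integralClosureToAbsIntegers R)) :=
    Ideal.Quotient.field _
  haveI : Finite (R ⧸ (𝔓.comap (F.integralClosureToAbsIntegers R)).under R) := by
    rw [hunder]
    infer_instance
  haveI : PerfectField (R ⧸ (𝔓.comap (F.integralClosureToAbsIntegers R)).under R) :=
    PerfectField.ofFinite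
  haveI : Algebra.IsAlgebraic (R ⧸ (𝔓.comap (F.integralClosureToAbsIntegers R)).under R)
      (integralClosure R F ⧸ 𝔓.comap (F.integralClosureToAbsIntegers R)) :=
    Algebra.IsIntegral.isAlgebraic
  exact Algebra.IsAlgebraic.isSeparable_of_perfectField

variable [IsDedekindDomain R] [IsFractionRing R K] [FiniteDimensional K E'] [Normal K E']
  [Algebra.IsSeparable K E'] [𝔓.IsMaximal] [Finite (R ⧸ 𝔓.under R)]

/-- **Herbrand's theorem for `E'/restrict hle/K`**: the instance of the parent's named fact
`herbrand_quotient` (hypothesis `hq`) for the finite Galois extension `E'/K` (Galois: normal and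
separable), its normal subextension `restrict hle ≅ E` and the maximal ideal `𝔓 ∩ E'`, whose
hypotheses (maximality, separable residue extension) are supplied by
`isMaximal_comap_integralClosureToAbsIntegers` and `isSeparable_residue_comap`.
[cite: SerreLocalFields1979, Ch. IV §3 Prop. 14] -/
theorem upperRamificationSubgroup_restrict_eq_map [Normal K (IntermediateField.restrict hle)]
    (hq : herbrand_quotient R (IntermediateField.restrict hle)) (v : ℝ) :
    upperRamificationSubgroup ((𝔓.comap (E'.integralClosureToAbsIntegers R)).comap
        ((IntermediateField.restrict hle).integralClosureInclusion R))
      (IntermediateField.restrict hle ≃ₐ[K] IntermediateField.restrict hle) v =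
    (upperRamificationSubgroup (𝔓.comap (E'.integralClosureToAbsIntegers R)) (E' ≃ₐ[K] E') v).map
      (AlgEquiv.restrictNormalHom (IntermediateField.restrict hle)) := by
  haveI : IsGalois K E' := {}
  haveI := isMaximal_comap_integralClosureToAbsIntegers R 𝔓 E'
  haveI := isSeparable_residue_comap R 𝔓 E'
  exact hq _ v

/-- **Herbrand's theorem for the layer `E ≤ E'` of `K̄`, descending half**: for
`σ ∈ Gal(K̄/K)`, if `σ|_{E'} ∈ Gal(E'/K)^v` then `σ|_E ∈ Gal(E/K)^v` (the image of `Gal(E'/K)^v`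
under restriction is contained in `Gal(E/K)^v`).
[cite: SerreLocalFields1979, Ch. IV §3 Prop. 14] -/
theorem absRestrictNormalHom_mem_upper_of_le [Normal K E]
    (hq : herbrand_quotient R (IntermediateField.restrict hle)) (v : ℝ)
    (σ : absoluteGaloisGroup K)
    (hσ : absRestrictNormalHom E' σ ∈
      upperRamificationSubgroup (𝔓.comap (E'.integralClosureToAbsIntegers R)) (E' ≃ₐ[K] E') v) :
    absRestrictNormalHom E σ ∈
      upperRamificationSubgroup (𝔓.comap (E.integralClosureToAbsIntegers R)) (E ≃ₐ[K] E) v := by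
  haveI : Normal K (IntermediateField.restrict hle) :=
    Normal.of_algEquiv (IntermediateField.restrict_algEquiv hle)
  rw [upperRamificationSubgroup_layer R hle 𝔓 v, Subgroup.mem_comap, MulEquiv.coe_toMonoidHom,
    ← restrictNormalHom_restrict_absRestrictNormalHom hle σ,
    upperRamificationSubgroup_restrict_eq_map R hle 𝔓 hq v]
  exact ⟨_, hσ, rfl⟩

/-- **Herbrand's theorem for the layer `E ≤ E'` of `K̄`, lifting half**: every `g ∈ Gal(E/K)^v`
is `σ|_E` for some `σ ∈ Gal(K̄/K)` with `σ|_{E'} ∈ Gal(E'/K)^v` (the image of `Gal(E'/K)^v` under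
restriction contains `Gal(E/K)^v`; `Gal(K̄/K) → Gal(E'/K)` is onto).
[cite: SerreLocalFields1979, Ch. IV §3 Prop. 14] -/
theorem exists_absRestrictNormalHom_mem_upper_of_le [Normal K E]
    (hq : herbrand_quotient R (IntermediateField.restrict hle)) (v : ℝ) (g : E ≃ₐ[K] E)
    (hg : g ∈ upperRamificationSubgroup (𝔓.comap (E.integralClosureToAbsIntegers R)) (E ≃ₐ[K] E) v) :
    ∃ σ : absoluteGaloisGroup K,
      absRestrictNormalHom E' σ ∈
        upperRamificationSubgroup (𝔓.comap (E'.integralClosureToAbsIntegers R)) (E' ≃ₐ[K] E') v ∧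
      absRestrictNormalHom E σ = g := by
  haveI : Normal K (IntermediateField.restrict hle) :=
    Normal.of_algEquiv (IntermediateField.restrict_algEquiv hle)
  rw [upperRamificationSubgroup_layer R hle 𝔓 v, Subgroup.mem_comap, MulEquiv.coe_toMonoidHom,
    upperRamificationSubgroup_restrict_eq_map R hle 𝔓 hq v] at hg
  obtain ⟨h, hh, hhg⟩ := hg
  obtain ⟨σ, rfl⟩ := (AlgEquiv.restrictNormalHom_surjective (F := K) (E := AlgebraicClosure K)
    (K₁ := E')).comp (absoluteGaloisGroup.toAlgEquiv K).surjective h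
  refine ⟨σ, hh, ?_⟩
  apply ((IntermediateField.restrict_algEquiv hle).autCongr).injective
  rw [← restrictNormalHom_restrict_absRestrictNormalHom hle σ]
  exact hhg

end TowerHerbrand

/-! ### Herbrand's theorem for `K̄/E/K` by compactness -/

section Compactness

open Field Topology

universe u

variable (R : Type*) {K : Type u} [CommRing R] [IsDedekindDomain R] [Field K] [CharZero K]
  [Algebra R K] [IsFractionRing R K]

/-- **Herbrand's theorem for `K̄/E/K`: `Γ_K^v|_E = Gal(E/K)^v`.**  Let `K` have characteristic
`0`, `K = Frac R` with `R` Dedekind, `𝔓` a maximal ideal of `\bar ℤ_K = absIntegers R K` with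
finite residue field `R/(𝔓 ∩ R)`, and `E/K` a finite normal subextension of `K̄`.  Then the image of
`Γ_K^v = absUpperRamificationSubgroup R 𝔓 v` under `σ ↦ σ|_E` is `Gal(E/K)^v` (at `𝔓 ∩ E`), for
every `v : ℝ`.  The inclusion `≤` is the definition of `Γ_K^v`; `≥` is the passage to the limit
from Herbrand's theorem at the finite layers (hypothesis `hq`, the parent's named fact
`herbrand_quotient` for all layers of `K̄`): for `g ∈ Gal(E/K)^v` the sets
`S_{E'} = {σ : σ|_{E'} ∈ Gal(E'/K)^v ∧ σ|_E = g}`, `E' ⊇ E` finite normal, are closed (restriction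
is continuous to the discrete finite level), non-empty (`exists_absRestrictNormalHom_mem_upper_of_le`)
and directed (`absRestrictNormalHom_mem_upper_of_le` for `E' ≤ E' ⊔ E''`), hence have a common
point by compactness of `Γ_K` (Cantor's intersection theorem); such a `σ` restricts to `g` and
lies in `Γ_K^v`, its restriction to any finite normal `E₁` being in `Gal(E₁/K)^v` by the
descending half applied to `E₁ ≤ E ⊔ E₁`.
Ref: Serre, *Local Fields*, Ch. IV §3, Prop. 14 and Remark 1 ("one can define `G^v` as
`lim← G(L'/K)^v`").  [cite: SerreLocalFields1979, Ch. IV §3 Prop. 14 and Remark 1] -/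
theorem absUpperRamificationSubgroup_map_eq_of_herbrand_quotient
    (hq : ∀ {E E' : IntermediateField K (AlgebraicClosure K)} (hle : E ≤ E'),
      herbrand_quotient R (IntermediateField.restrict hle))
    (𝔓 : Ideal (absIntegers R K)) [𝔓.IsMaximal] [Finite (R ⧸ 𝔓.under R)]
    (E : IntermediateField K (AlgebraicClosure K)) [FiniteDimensional K E] [Normal K E] (v : ℝ) :
    (absUpperRamificationSubgroup R 𝔓 v).map (absRestrictNormalHom E) =
      upperRamificationSubgroup (𝔓.comap (E.integralClosureToAbsIntegers R)) (E ≃ₐ[K] E) v := by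
  apply le_antisymm
  · rintro _ ⟨σ, hσ, rfl⟩
    exact (mem_absUpperRamificationSubgroup_iff.mp hσ) E
  intro g hg
  -- the index type of finite normal layers above `E`
  let J := {E' : IntermediateField K (AlgebraicClosure K) //
    E ≤ E' ∧ FiniteDimensional K E' ∧ Normal K E'}
  let S : J → Set (absoluteGaloisGroup K) := fun j =>
    {σ | @absRestrictNormalHom K _ j.1 j.2.2.2 σ ∈
        upperRamificationSubgroup (𝔓.comap (j.1.integralClosureToAbsIntegers R)) (j.1 ≃ₐ[K] j.1) v ∧
      absRestrictNormalHom E σ = g}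
  have j0 : J := ⟨E, le_rfl, ‹_›, ‹_›⟩
  haveI : Nonempty J := ⟨j0⟩
  -- monotonicity of `S` along `E' ≤ E''` (tower Herbrand, descending)
  have hmono : ∀ (j j' : J), j.1 ≤ j'.1 → S j' ⊆ S j := by
    rintro ⟨E₁, hE₁, hfd₁, hn₁⟩ ⟨E₂, hE₂, hfd₂, hn₂⟩ h12 σ ⟨hσ, hσg⟩
    refine ⟨?_, hσg⟩
    exact absRestrictNormalHom_mem_upper_of_le R h12 𝔓 (hq h12) v σ hσ
  -- non-emptiness (tower Herbrand, lifting)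
  have hne : ∀ j : J, (S j).Nonempty := by
    rintro ⟨E₁, hE₁, hfd₁, hn₁⟩
    obtain ⟨σ, hσ, hσg⟩ := exists_absRestrictNormalHom_mem_upper_of_le R hE₁ 𝔓 (hq hE₁) v g hg
    exact ⟨σ, hσ, hσg⟩
  -- closedness
  have hclosed : ∀ j : J, IsClosed (S j) := by
    rintro ⟨E₁, hE₁, hfd₁, hn₁⟩
    have hc₁ : Continuous (absRestrictNormalHom (K := K) E₁) :=
      (InfiniteGalois.restrictNormalHom_continuous E₁).comp continuous_id
    have hc : Continuous (absRestrictNormalHom (K := K) E) :=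
      (InfiniteGalois.restrictNormalHom_continuous E).comp continuous_id
    exact ((isClosed_discrete _).preimage hc₁).inter ((isClosed_discrete {g}).preimage hc)
  -- directedness
  have hdir : Directed (· ⊇ ·) S := by
    rintro ⟨E₁, hE₁, hfd₁, hn₁⟩ ⟨E₂, hE₂, hfd₂, hn₂⟩
    refine ⟨⟨E₁ ⊔ E₂, le_sup_of_le_left hE₁, inferInstance, inferInstance⟩, ?_, ?_⟩
    · exact hmono ⟨E₁, hE₁, hfd₁, hn₁⟩ _ le_sup_left
    · exact hmono ⟨E₂, hE₂, hfd₂, hn₂⟩ _ le_sup_right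
  -- compactness
  obtain ⟨σ, hσ⟩ := IsCompact.nonempty_iInter_of_directed_nonempty_isCompact_isClosed S hdir hne
    (fun j => (hclosed j).isCompact) hclosed
  rw [Set.mem_iInter] at hσ
  refine ⟨σ, ?_, (hσ j0).2⟩
  rw [SetLike.mem_coe, mem_absUpperRamificationSubgroup_iff]
  intro E₁ _ _
  have h := (hσ ⟨E ⊔ E₁, le_sup_left, inferInstance, inferInstance⟩).1
  exact absRestrictNormalHom_mem_upper_of_le R (le_sup_right : E₁ ≤ E ⊔ E₁) 𝔓
    (hq le_sup_right) v σ h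

end Compactness



end Literature.NumberTheory.GaloisRepresentations
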